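import Literature.AlgebraicGeometry.AbelianSchemes.PolarizationTypeLocallyConstant
import Literature.AlgebraicGeometry.AbelianSchemes.AbelianSchemePolarizationBaseChange
import Literature.AlgebraicGeometry.Morphisms.LocallyNoetherianLocallyConnected
import HarnessLib

/-!
# The type-`δ` locus of a polarisation is open and closed (componentwise form of the local constancy of the type)

Layer `Literature/AlgebraicGeometry/AbelianSchemes`, namespace `Literature.AlgebraicGeometry.AbelianSchemes.AbelianSchemeOver.Polarization`.
Cell `hodgecm-mathlib` (D-0151), F-DAG price sheet §5b second-wave hand (h9) «local constancy of the type», FILE 2δ =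
socket (2c) asked by the price-sheet pen (B-p03 (g16)) for the consumer F-6 (V′): the sub-locus `H_{g,δ,N} ⊆ H_{g,d,N}` of
polarised abelian schemes of TYPE `δ` is OPEN AND CLOSED ([MumfordFogartyKirwan1994] App. 7A: «`𝒜_{g,d,n}` is the
disjoint union of the open and closed subschemes `𝒜_{g,δ,n}`»).  Author B-p02 (g12); count-neutral capital, PROOF lane,
theorems only.  HC_CM is proved only modulo the 7 printed citations until rung 0 closes; this file asserts nothing about HC.

## What is proved (no `def`, no named fact, no instance, no notation, no `sorry`)

For a polarisation `λ` of an abelian scheme `A/S` and a polarisation type `δ`, write «the `δ`-clause holds at the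
geometric point `s̄`» for: the kernel `K(λ̄_s̄)` on `Ω`-points is the image of an injective homomorphism from
`(∏ᵢ ℤ/δᵢ)²` (the pointwise clause of ★ `Polarization.HasType`).

* `exists_mulHom_baseChange_iff` — the `δ`-clause for `λ ×_S S'` at `t` ⟺ the `δ`-clause for `λ` at `t ≫ g`
  (★ `fibrePointsMulEquiv`, ★ `mem_kerPointsAt_baseChange_iff`);
* `forall_exists_mulHom_of_mem_connectedComponent` — on a locally connected base with every positive integer invertible
  in its residue fields: if the `δ`-clause holds at every geometric point over `x`, it holds at every geometric point over
  every `y` in the connected component of `x` (the head ★ `hasType_of_exists_mulHom_at` applied to the OPEN subscheme on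
  the connected component, ★ `Polarization.baseChange` along its inclusion);
* **`isClopen_setOf_forall_exists_mulHom`** — the set of `x ∈ S` over which the `δ`-clause holds at every geometric
  point is OPEN AND CLOSED; `isClopen_setOf_forall_exists_mulHom_of_isLocallyNoetherian` — the same for a locally
  Noetherian base (★ `locallyConnectedSpace_of_isLocallyNoetherian`).

## References
* [MumfordFogartyKirwan1994] D. Mumford, J. Fogarty, F. Kirwan, *Geometric Invariant Theory*, 3rd ed. (1994), App. 7A
  (pp. 234–235).
-/

noncomputable section

universe u

open CategoryTheory CategoryTheory.Limits AlgebraicGeometry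

open scoped MonObj

namespace Literature.AlgebraicGeometry.AbelianSchemes

namespace AbelianSchemeOver

namespace Polarization

open Literature.AlgebraicGeometry.Motives Literature.AlgebraicGeometry.ModuliOfAbelianVarieties
  Literature.AlgebraicGeometry.Morphisms

variable {S : Scheme.{u}} {A : AbelianSchemeOver S} {D : A.DualPair} (pol : A.Polarization D)

/-! ### §1 The `δ`-clause along a base change -/

/-- **The `δ`-clause is invariant under base change at a point**: for `g : S' → S` and a geometric point `t` of `S'`, the
kernel of `(λ ×_S S')‾_t` is the image of an injective homomorphism from `(∏ᵢ ℤ/δᵢ)²` iff the kernel of `λ̄_{t ≫ g}` is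
— the group isomorphism `(A_{S'})_t(Ω) ≅ A_{t ≫ g}(Ω)` (★ `fibrePointsMulEquiv`) carries one kernel onto the other
(★ `mem_kerPointsAt_baseChange_iff`). [cite: MumfordFogartyKirwan1994, App. 7A (pp. 234–235)] -/
theorem exists_mulHom_baseChange_iff {S' : Scheme.{u}} (g : S' ⟶ S) {g₀ : ℕ} (δ : Fin g₀ → ℕ) {Ω : Type u} [Field Ω]
    (t : Spec (.of Ω) ⟶ S') :
    (∃ φ : Multiplicative (((i : Fin g₀) → ZMod (δ i)) × ((i : Fin g₀) → ZMod (δ i))) →*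
        ((A.baseChange g).fibre t).toAbelianVariety.Points Ω,
        Function.Injective φ ∧ Set.range φ = (pol.baseChange g).kerPointsAt t) ↔
      ∃ φ : Multiplicative (((i : Fin g₀) → ZMod (δ i)) × ((i : Fin g₀) → ZMod (δ i))) →*
        (A.fibre (t ≫ g)).toAbelianVariety.Points Ω,
        Function.Injective φ ∧ Set.range φ = pol.kerPointsAt (t ≫ g) := by
  have hker : ∀ P', P' ∈ (pol.baseChange g).kerPointsAt t ↔ A.fibrePointsMulEquiv g t P' ∈ pol.kerPointsAt (t ≫ g) :=
    fun P' => pol.mem_kerPointsAt_baseChange_iff g t P'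
  constructor
  · rintro ⟨φ, hinj, hrange⟩
    refine ⟨(A.fibrePointsMulEquiv g t).toMonoidHom.comp φ, (A.fibrePointsMulEquiv g t).injective.comp hinj, ?_⟩
    ext P
    constructor
    · rintro ⟨x, rfl⟩
      exact (hker (φ x)).1 (hrange ▸ ⟨x, rfl⟩)
    · intro hP
      have hP' : (A.fibrePointsMulEquiv g t).symm P ∈ (pol.baseChange g).kerPointsAt t := by
        rw [hker, MulEquiv.apply_symm_apply]
        exact hP
      rw [← hrange] at hP'
      obtain ⟨x, hx⟩ := hP'
      exact ⟨x, by rw [MonoidHom.coe_comp, Function.comp_apply, MulEquiv.coe_toMonoidHom, hx,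
        MulEquiv.apply_symm_apply]⟩
  · rintro ⟨φ, hinj, hrange⟩
    refine ⟨(A.fibrePointsMulEquiv g t).symm.toMonoidHom.comp φ, (A.fibrePointsMulEquiv g t).symm.injective.comp hinj, ?_⟩
    ext P'
    rw [hker, ← hrange]
    constructor
    · rintro ⟨x, rfl⟩
      exact ⟨x, by rw [MonoidHom.coe_comp, Function.comp_apply, MulEquiv.coe_toMonoidHom, MulEquiv.apply_symm_apply]⟩
    · rintro ⟨x, hx⟩
      exact ⟨x, by rw [MonoidHom.coe_comp, Function.comp_apply, MulEquiv.coe_toMonoidHom, MulEquiv.symm_apply_eq, hx]⟩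

/-! ### §2 The `δ`-clause spreads over connected components -/

/-- A geometric point whose image lies in an open `U ⊆ S` factors through the open subscheme `U`. [folklore] -/
private theorem exists_lift_of_mem_opens (U : S.Opens) {Ω : Type u} [Field Ω] (s : Spec (.of Ω) ⟶ S)
    (hs : s.base (IsLocalRing.closedPoint Ω) ∈ U) : ∃ s' : Spec (.of Ω) ⟶ (U : Scheme.{u}), s' ≫ U.ι = s := by
  have hr : Set.range s.base ⊆ Set.range U.ι.base := by
    rintro _ ⟨p, rfl⟩
    rw [Scheme.Opens.range_ι, Subsingleton.elim p (IsLocalRing.closedPoint Ω)]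
    exact hs
  exact ⟨IsOpenImmersion.lift U.ι s hr, IsOpenImmersion.lift_fac U.ι s hr⟩

/-- **The `δ`-clause SPREADS OVER CONNECTED COMPONENTS.**  Let `S` be locally connected with every positive integer
invertible in its residue fields, `δ` a polarisation type, and suppose the `δ`-clause holds at every geometric point over
`x ∈ S`.  Then it holds at every geometric point over every `y` in the connected component of `x`: the connected
component is an OPEN subscheme `U`, the restriction `λ ×_S U` has type `δ` by the head ★ `hasType_of_exists_mulHom_at`
(the clause transported to `U` at a geometric point over `x`, `exists_mulHom_baseChange_iff`), and the clause comes back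
down at the geometric points over `y`. [cite: MumfordFogartyKirwan1994, App. 7A (pp. 234–235)] -/
theorem forall_exists_mulHom_of_mem_connectedComponent [LocallyConnectedSpace S]
    (hchar : ∀ (s : S) (m : ℕ), 0 < m → (m : S.residueField s) ≠ 0) {g : ℕ} {δ : Fin g → ℕ}
    (hδ : IsPolarizationType δ) {x y : S} (hy : y ∈ connectedComponent x)
    (hx : ∀ (Ω : Type u) [Field Ω] [IsAlgClosed Ω] (s : Spec (.of Ω) ⟶ S), s.base (IsLocalRing.closedPoint Ω) = x →
      ∃ φ : Multiplicative (((i : Fin g) → ZMod (δ i)) × ((i : Fin g) → ZMod (δ i))) →*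
        (A.fibre s).toAbelianVariety.Points Ω, Function.Injective φ ∧ Set.range φ = pol.kerPointsAt s)
    {Ω : Type u} [Field Ω] [IsAlgClosed Ω] (t : Spec (.of Ω) ⟶ S) (ht : t.base (IsLocalRing.closedPoint Ω) = y) :
    ∃ φ : Multiplicative (((i : Fin g) → ZMod (δ i)) × ((i : Fin g) → ZMod (δ i))) →*
      (A.fibre t).toAbelianVariety.Points Ω, Function.Injective φ ∧ Set.range φ = pol.kerPointsAt t := by
  -- the connected component as an open subscheme `U`, preconnected, with the same residue characteristics
  let U : S.Opens := ⟨connectedComponent x, isOpen_connectedComponent⟩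
  haveI : PreconnectedSpace (U : Scheme.{u}) :=
    Subtype.preconnectedSpace (isPreconnected_connectedComponent (x := x))
  have hcharU : ∀ (u : (U : Scheme.{u})) (m : ℕ), 0 < m → (m : (U : Scheme.{u}).residueField u) ≠ 0 := by
    intro u m hm
    have h := (map_ne_zero (U.ι.residueFieldMap u).hom).mpr (hchar (U.ι.base u) m hm)
    rwa [map_natCast] at h
  -- a geometric point over `x`, lifted to `U`, where the clause holds for `λ ×_S U`
  let Ω₀ : Type u := AlgebraicClosure (S.residueField x)
  let s₀ : Spec (.of Ω₀) ⟶ S := Spec.map (CommRingCat.ofHom (algebraMap (S.residueField x) Ω₀)) ≫ S.fromSpecResidueField x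
  have hs₀ : s₀.base (IsLocalRing.closedPoint Ω₀) = x := by
    change (S.fromSpecResidueField x).base _ = x
    exact Scheme.fromSpecResidueField_apply x _
  obtain ⟨s₀', hs₀'⟩ := exists_lift_of_mem_opens U s₀ (by rw [hs₀]; exact mem_connectedComponent)
  have h₀' := (pol.exists_mulHom_baseChange_iff U.ι δ s₀').2 (by rw [hs₀']; exact hx Ω₀ s₀ hs₀)
  have hT : (pol.baseChange U.ι).HasType δ := (pol.baseChange U.ι).hasType_of_exists_mulHom_at hcharU hδ s₀' h₀'
  -- the given point over `y` lifts to `U`; bring the clause back down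
  obtain ⟨t', ht'⟩ := exists_lift_of_mem_opens U t (by rw [ht]; exact hy)
  subst ht'
  exact (pol.exists_mulHom_baseChange_iff U.ι δ t').1 (HasType.exists_mulHom _ hT Ω t')

/-! ### §3 The type-`δ` locus is open and closed -/

/-- **THE TYPE-`δ` LOCUS IS OPEN AND CLOSED** ([MumfordFogartyKirwan1994] App. 7A: «`𝒜_{g,d,n}` is the disjoint union of
the open and closed subschemes `𝒜_{g,δ,n}`»): on a locally connected base `S` with every positive integer invertible in its
residue fields (e.g. a locally Noetherian `ℚ`-scheme), the set of points `x ∈ S` such that the `δ`-clause (kernel of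
`λ̄` on `Ω`-points `≅ (∏ᵢ ℤ/δᵢ)²`) holds at every geometric point over `x` is a union of connected components, hence open
and closed. [cite: MumfordFogartyKirwan1994, App. 7A (pp. 234–235)] -/
theorem isClopen_setOf_forall_exists_mulHom [LocallyConnectedSpace S]
    (hchar : ∀ (s : S) (m : ℕ), 0 < m → (m : S.residueField s) ≠ 0) {g : ℕ} {δ : Fin g → ℕ}
    (hδ : IsPolarizationType δ) :
    IsClopen {x : S | ∀ (Ω : Type u) [Field Ω] [IsAlgClosed Ω] (s : Spec (.of Ω) ⟶ S),
      s.base (IsLocalRing.closedPoint Ω) = x →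
        ∃ φ : Multiplicative (((i : Fin g) → ZMod (δ i)) × ((i : Fin g) → ZMod (δ i))) →*
          (A.fibre s).toAbelianVariety.Points Ω, Function.Injective φ ∧ Set.range φ = pol.kerPointsAt s} := by
  -- the locus `T` is saturated for the connected components
  have hsat : ∀ x y : S, y ∈ connectedComponent x →
      (x ∈ {x : S | ∀ (Ω : Type u) [Field Ω] [IsAlgClosed Ω] (s : Spec (.of Ω) ⟶ S),
        s.base (IsLocalRing.closedPoint Ω) = x →
          ∃ φ : Multiplicative (((i : Fin g) → ZMod (δ i)) × ((i : Fin g) → ZMod (δ i))) →*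
            (A.fibre s).toAbelianVariety.Points Ω, Function.Injective φ ∧ Set.range φ = pol.kerPointsAt s} ↔
      y ∈ {x : S | ∀ (Ω : Type u) [Field Ω] [IsAlgClosed Ω] (s : Spec (.of Ω) ⟶ S),
        s.base (IsLocalRing.closedPoint Ω) = x →
          ∃ φ : Multiplicative (((i : Fin g) → ZMod (δ i)) × ((i : Fin g) → ZMod (δ i))) →*
            (A.fibre s).toAbelianVariety.Points Ω, Function.Injective φ ∧ Set.range φ = pol.kerPointsAt s}) := by
    intro x y hy
    exact ⟨fun hx Ω _ _ t ht => pol.forall_exists_mulHom_of_mem_connectedComponent hchar hδ hy hx t ht,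
      fun hy' Ω _ _ t ht => pol.forall_exists_mulHom_of_mem_connectedComponent hchar hδ
        (connectedComponent_eq hy ▸ mem_connectedComponent) hy' t ht⟩
  constructor
  · -- closed: the complement is a union of (open) connected components
    rw [← isOpen_compl_iff, isOpen_iff_mem_nhds]
    intro x hx
    exact Filter.mem_of_superset (isOpen_connectedComponent.mem_nhds mem_connectedComponent)
      fun y hy hy' => hx ((hsat x y hy).2 hy')
  · -- open: a union of (open) connected components
    rw [isOpen_iff_mem_nhds]
    intro x hx
    exact Filter.mem_of_superset (isOpen_connectedComponent.mem_nhds mem_connectedComponent)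
      fun y hy => (hsat x y hy).1 hx

/-- **The type-`δ` locus is open and closed on a locally Noetherian base** (its underlying space is locally connected,
★ `Morphisms.locallyConnectedSpace_of_isLocallyNoetherian`) — the literal F-6 (V′) socket: `H_{g,δ,N}` is open and
closed in `H_{g,d,N}`. [cite: MumfordFogartyKirwan1994, App. 7A (pp. 234–235)] -/
theorem isClopen_setOf_forall_exists_mulHom_of_isLocallyNoetherian [IsLocallyNoetherian S]
    (hchar : ∀ (s : S) (m : ℕ), 0 < m → (m : S.residueField s) ≠ 0) {g : ℕ} {δ : Fin g → ℕ}
    (hδ : IsPolarizationType δ) :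
    IsClopen {x : S | ∀ (Ω : Type u) [Field Ω] [IsAlgClosed Ω] (s : Spec (.of Ω) ⟶ S),
      s.base (IsLocalRing.closedPoint Ω) = x →
        ∃ φ : Multiplicative (((i : Fin g) → ZMod (δ i)) × ((i : Fin g) → ZMod (δ i))) →*
          (A.fibre s).toAbelianVariety.Points Ω, Function.Injective φ ∧ Set.range φ = pol.kerPointsAt s} := by
  haveI := locallyConnectedSpace_of_isLocallyNoetherian S
  exact pol.isClopen_setOf_forall_exists_mulHom hchar hδ

end Polarization

end AbelianSchemeOver

end Literature.AlgebraicGeometry.AbelianSchemes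

end
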